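import Summits.Langlands.Langlands.Theses.SqrtFiveQuarticCovers
import Literature.NumberTheory.Automorphic.TotallyRealModularitySmallImage
import HarnessLib

/-!
# Route `SqrtFiveQuarticCovers` — crux `BoxBorelFive` (stmt-Langlands-17835) from Box's printed
# `b5`-locus theorem (Box 2022, Thm. 1.5 with Thm. 1.4)

`Summit.Langlands.Langlands.Theses.SqrtFiveQuarticCovers.BoxBorelFive` says: for `K` totally real
quartic with `√5 ∈ K` and `E / 𝓞 K` (`Δ ≠ 0`) admitting framings of `E[3], E[5], E[7]` with
mod-`3` image in `B(3)` or `C_s⁺(3)`, mod-`5` image in `B(5)`, mod-`7` image in `B(7)` or `G(e7)`,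
the curve is modular (geometric CM, or a weight-zero cuspidal `π` of `GL₂(𝔸_K)` whose
`T_w`-eigenvalue is `a_w(E)` at cofinitely many finite places `w` — the summit's cone, i.e.
`Literature.NumberTheory.Automorphic.IsModularEllipticCurve K E` written out).

This is the `√5 ∈ K` SPECIALISATION of the tree's named fact
`Literature.NumberTheory.Automorphic.Box2022_theorem1_5_modular` (file
`Literature/NumberTheory/Automorphic/TotallyRealModularitySmallImage.lean`): J. Box, *Elliptic
curves over totally real quartic fields not containing `√5` are modular*, Trans. AMS 375 (2022) =
arXiv:2103.13975, Thm. 1.5 (all quartic points with quartic `j` on the four `b5`-curves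
`X₀(105)`, `X(s3,b5,b7)`, `X(b3,b5,e7)`, `X(s3,b5,e7)` are `ℚ`-curves or carry a non-totally-real
`j` of Table 1) with Thm. 1.4 (Ribet: `ℚ`-curves are modular) and the small-`j` paragraph of p. 5
— a statement about ALL totally real quartic `K`, no hypothesis on `√5` (the route's "why it might
fail" — did Box's sieve use `√5 ∉ K`? — is answered in the negative by the refuter's reading of
Thm. 1.5 / Thm. 3.1 / Rem. 5.2 / §7.1, recorded on the item).

HONEST STATUS.  The theorem below is CONDITIONAL on that named fact (a published theorem, cited,
not proved in the tree): it takes `(h : Box2022_theorem1_5_modular)`.  Nothing here proves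
modularity of a new class of elliptic curves; it is bookkeeping that turns Box's printed theorem,
as vendored, into the route's binder `h₄` of `closes`.  The two bridges used are proved tree
lemmas: `Box2022_theorem1_5_modular.isHilbertModular` (cofinite Hecke-polynomial form) and
`IsHilbertModular.isModularEllipticCurve` (trace form = the written-out cone); the route's
written-out `WeierstrassCurve.IsTorsionGaloisRep` and `IsModularEllipticCurve` close by `δ`.

References: [Box2022] J. Box, Trans. AMS 375 (2022), doi:10.1090/tran/8557 = arXiv:2103.13975,
§1.1, Thms. 1.4–1.5 (p. 5), Thms. 3.1, 4.1, 6.1, Cor. 5.3; [Ribet2004QCurves] K. Ribet, Progr.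
Math. 224 (2004) 241–261.
-/

noncomputable section

set_option linter.dupNamespace false -- project-wide option; `Summit.Langlands.Langlands` is the mandated namespace

open scoped MatrixGroups NumberField
open NumberField
open Literature.NumberTheory.Automorphic Literature.NumberTheory.GaloisRepresentations
open Summit.Langlands.Langlands.Theses.SqrtFiveQuarticCovers

namespace Summit.Langlands.Langlands.Theorems

/-- **`BoxBorelFive` from Box 2022 Thm. 1.5 + Thm. 1.4 (named fact `Box2022_theorem1_5_modular`).**
For `K` totally real quartic with `√5 ∈ K` and `E / 𝓞 K` (`Δ ≠ 0`) with mod-`3` image in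
`B(3)` or `C_s⁺(3)`, mod-`5` image in `B(5)` and mod-`7` image in `B(7)` or `G(e7)` (each for
some framing of `E[p]`), `E` is modular in the route's written-out sense.  Proof: the fact gives
`IsAutomorphicOfWeightZero E` for every totally real quartic `K` (the hypothesis `√5 ∈ K` is not
used), `Box2022_theorem1_5_modular.isHilbertModular` and `IsHilbertModular.isModularEllipticCurve`
translate it into the cone; the written-out framing hypotheses are `IsTorsionGaloisRep` by `δ`.
CONDITIONAL on the named fact (Box's published theorem, cited not proved).
[cite: Box2022, Thm. 1.5, Thm. 1.4, §1.1 (p. 5)] -/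
theorem BoxBorelFive_of_Box2022_theorem1_5_modular (h : Box2022_theorem1_5_modular) :
    BoxBorelFive := by
  intro K _ _ hK hd _h5 E hE h3 hb5 h7
  haveI : IsTotallyReal K := hK
  exact (Box2022_theorem1_5_modular.isHilbertModular h K hd hE h3 hb5 h7).isModularEllipticCurve

end Summit.Langlands.Langlands.Theorems

end
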